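import Literature.AlgebraicGeometry.Resolution.ArithmeticalThreefoldsLocalUnramifiedClimb
import Literature.AlgebraicGeometry.Resolution.ArithmeticalThreefoldsLocalRamifiedClimb
import Literature.AlgebraicGeometry.Resolution.ArithmeticalThreefoldsLocalInseparable
import Mathlib.FieldTheory.SeparableClosure
import Mathlib.FieldTheory.NormalizedTrace
import Mathlib.RingTheory.Polynomial.Cyclotomic.Roots
import HarnessLib

/-!
# Cossart–Piltant's reduction `(Thm. 1.5) ⇒ (LU for complete local domains)`, from four named inputs

Topic: `Literature/AlgebraicGeometry/Resolution`. PROOF side of `CossartPiltant2019ReductionP`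
(`ArithmeticalThreefoldsLocal.lean`). This file assembles the whole chain of the proof of
Cossart–Piltant 2019, Prop. 4.10 (arXiv v1 Prop. 4.8, pp. 53–54),

> `(LU v₀) ⇒ (LU v₀ⁱ) ⇒ (LU v₀ʳ) ⇒ (LU vʳ) ⇒ (LU vⁱ) ⇒ (LU v)`,

from the pieces proved in this tree — the reduction to climbing over the Cohen subring
(`cossartPiltant2019ReductionP_of_climb`), the purely inseparable climb
(`ArithmeticalThreefoldsLocalInseparable.lean`), the unramified ascent `F → Fⁱ` modulo cofinality
(`ArithmeticalThreefoldsLocalUnramifiedClimb.lean`), the structure of `Fʳ | Fⁱ`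
(`isPrimeGaloisTower_inertiaField_ramificationField`) and the climb above the ramification field
by Thm. 1.5 (ii) (`ArithmeticalThreefoldsLocalRamifiedClimb.lean`) — and from the four inputs of
the printed proof that are NOT (yet) theorems of the tree, taken as hypotheses in the exact
shape in which the chain consumes them:

* **(COF) cofinality of local uniformizations** — [CoP1] Cor. 4.6 (from principalization,
  [CoP1] Prop. 4.2 = Cossart–Piltant 2019 Prop. 4.4, the named fact
  `CossartPiltant2019Principalization`): a model regular at the centre of `v` can be replaced by
  one whose local ring contains finitely many given elements of `O_v`;
* **(C3) tame ascent** — [CoP1] Prop. 6.3 (HAL Prop. 8.3, via refined monomialization and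
  Perron transforms) as used in the proof of [CoP1] Thm. 8.1 for the steps of the tower
  `Fⁱ ⊆ ⋯ ⊆ Fʳ`: `(LU)` ascends a Galois step of prime degree `ℓ ≠ p` between the inertia and
  the ramification field, for a rank-one valuation;
* **(C4) descent below the ramification field** — [CoP1] Prop. 9.3 (HAL Prop. 9.5): for `L | K`
  finite Galois and `K ⊆ K′ ⊆ Kʳ`, `(LU W ∩ K′) ⇒ (LU V)`, for a rank-one valuation;
* **(C5) reduction to rank one** — [NSp] Novacoski–Spivakovsky 2014 Thm. 1.1 / [CoP1] Prop. 5.1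
  ("it is sufficient to deal with the case `dim O_v = 1`", Cossart–Piltant 2019, proof of
  Prop. 4.10), in the climbing frame.

* `IsPrimeGaloisTower.induction_between` — induction along a prime Galois tower keeping track of
  the position between its ends.
* `exists_intermediateField_lift_toSubfield_eq`, `lift_fixedField_inf_fixingSubgroup_le_ramificationField`
  — bookkeeping: a subfield between `M` and `N` is an intermediate field of `N | M`; the
  ramification field of `N` over an intermediate field `L` contains `L · Fʳ` ([CoP1] Lemma 6.1
  (2): `Gʳ(S/R′) = Gʳ(S/R) ∩ Gal(L/K′)`).
* `charP_residueField_valuationSubring_of_dominates`, `charP_or_exists_isPrimitiveRoot` — the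
  residue characteristic of `O_Ω` is `p`; `Ω` has characteristic `p` or contains `ζ_p`.
* `cossartPiltant2019ReductionP_of_parts` — PROVED: **`CossartPiltant2019Local` and the four
  inputs (COF), (C3), (C4), (C5) imply `CossartPiltant2019ReductionP`.**

Everything is PROVED; no named facts are introduced.

## Sources

* V. Cossart, O. Piltant, J. Algebra 529 (2019) 268–535 = arXiv:1412.0868, proof of Prop. 4.10
  (arXiv v1: Prop. 4.8, pp. 53–54). [CossartPiltant2019]
* V. Cossart, O. Piltant, J. Algebra 320 (2008) 1051–1082: Cor. 4.6, Lemma 6.1, Prop. 6.3,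
  Thm. 8.1, Prop. 9.3 (HAL hal-00139124: Cor. 4.6, Lemma 6.1, Prop. 8.3, Thm. 7.2, Prop. 9.5).
  [CossartPiltant2008]
* J. Novacoski, M. Spivakovsky, *Reduction of local uniformization to the rank one case* (2014),
  Thm. 1.1. [NovacoskiSpivakovsky2014]
-/

noncomputable section

open IsLocalRing Polynomial IntermediateField Module

namespace Literature.AlgebraicGeometry.Resolution

universe u

/-! ## Bookkeeping on towers and intermediate fields -/

section Towers

variable {Ω : Type u} [Field Ω]

/-- Induction along a prime Galois tower `A ⊆ ⋯ ⊆ B`, for a property of subfields preserved by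
the steps of the tower lying between `A₀ ≤ A` and `B`. [folklore] -/
theorem IsPrimeGaloisTower.induction_between {p : ℕ} {A₀ B : Subfield Ω} (P : Subfield Ω → Prop)
    (hstep : ∀ M M₁ : Subfield Ω, A₀ ≤ M → M₁ ≤ B → IsPrimeGaloisStep p M M₁ → P M → P M₁)
    {A : Subfield Ω} (hA : A₀ ≤ A) (h : IsPrimeGaloisTower p A B) (hPA : P A) : P B := by
  induction h with
  | refl M => exact hPA
  | step hs ht ih =>
    exact ih hstep (hA.trans hs.le) (hstep _ _ hA ht.le hs hPA)

variable {M : Subfield Ω} (N : IntermediateField M Ω)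

/-- A subfield `L` of `Ω` with `M ≤ L ≤ N` is (the image of) an intermediate field of `N | M`.
[folklore] -/
theorem exists_intermediateField_lift_toSubfield_eq (L : Subfield Ω) (hML : M ≤ L)
    (hLN : L ≤ N.toSubfield) :
    ∃ L' : IntermediateField M N, (lift L').toSubfield = L ∧
      ∀ σ : N ≃ₐ[M] N, σ ∈ L'.fixingSubgroup ↔ ∀ x : N, (x : Ω) ∈ L → σ x = x := by
  let L' : IntermediateField M N :=
    (L.comap (algebraMap N Ω)).toIntermediateField fun m => by
      change ((algebraMap M N m : N) : Ω) ∈ L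
      exact hML m.2
  have hmem : ∀ x : N, x ∈ L' ↔ (x : Ω) ∈ L := fun x => Iff.rfl
  refine ⟨L', ?_, fun σ => ?_⟩
  · ext x
    constructor
    · intro hx
      have hxN : x ∈ N := IntermediateField.lift_le L' hx
      have hx' : (⟨x, hxN⟩ : N) ∈ L' := (IntermediateField.mem_lift (⟨x, hxN⟩ : N)).mp hx
      exact (hmem _).mp hx'
    · intro hx
      exact (IntermediateField.mem_lift (⟨x, hLN hx⟩ : N)).mpr ((hmem _).mpr hx)
  · rw [IntermediateField.mem_fixingSubgroup_iff]
    exact ⟨fun h x hx => h x ((hmem x).mpr hx), fun h x hx => h x ((hmem x).mp hx)⟩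

/-- **The ramification field over an intermediate base contains `L · Fʳ`** ([CoP1] Lemma 6.1
(2): "`Gʳ(S/R′) = Gʳ(S/R) ∩ Gal(L/K′)`" — here only the resulting inclusion of fields, for the
LARGE ramification group `G_V`, whose defining condition `v(σ x − x) > v(x)` does not mention
the base field): for `N | M` finite Galois with valuation `V ∩ N` and an intermediate field `L′`,
the fixed field of `G_V(N|M) ∩ Gal(N|L′)` lies in the ramification field of `N` over `L′`
(computed in the Galois group of `N` over `L′`, after rebasing with `TameTowerRebase.lean`).
[cite: CossartPiltant2008, Lemma 6.1 (2) (HAL p. 17)] -/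
theorem lift_fixedField_inf_fixingSubgroup_le_ramificationField (V : ValuationSubring Ω)
    [FiniteDimensional M N] [IsGalois M N] (L' : IntermediateField M N) :
    (lift (fixedField (ramificationGroupIn V N ⊓ L'.fixingSubgroup))).toSubfield ≤
      (lift (fixedField (ramificationGroupIn V
        (Subfield.extendScalars (lift_toSubfield_le L'))))).toSubfield := by
  classical
  obtain ⟨ψ, hψ⟩ := exists_rebaseAutEquiv L'
  intro x hx
  have hxN : x ∈ N := IntermediateField.lift_le _ hx
  have hx' : (⟨x, hxN⟩ : N) ∈ fixedField (ramificationGroupIn V N ⊓ L'.fixingSubgroup) :=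
    (IntermediateField.mem_lift (⟨x, hxN⟩ : N)).mp hx
  rw [IntermediateField.mem_fixedField_iff] at hx'
  -- `x` as an element of the rebased extension
  have hxN' : x ∈ Subfield.extendScalars (lift_toSubfield_le L') :=
    (mem_extendScalars_lift_iff L' x).mpr hxN
  refine (IntermediateField.mem_lift (⟨x, hxN'⟩ : Subfield.extendScalars (lift_toSubfield_le L'))).mpr ?_
  rw [IntermediateField.mem_fixedField_iff]
  intro σ hσ
  -- `ψ σ ∈ G_V(N|M) ∩ Gal(N|L′)`
  have hψσ : ((ψ σ : L'.fixingSubgroup) : N ≃ₐ[M] N) ∈ ramificationGroupIn V N ⊓ L'.fixingSubgroup := by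
    refine Subgroup.mem_inf.mpr ⟨?_, (ψ σ).2⟩
    refine (mem_ramificationGroupIn_iff V N _).mpr ?_
    intro y hy
    have h := (mem_ramificationGroupIn_iff V _ σ).mp hσ ⟨(y : Ω), (mem_extendScalars_lift_iff L' y).mpr y.2⟩
      (fun h0 => hy (by
        have : ((y : N) : Ω) = 0 := congrArg Subtype.val h0
        exact_mod_cast this))
    rw [← hψ σ y] at h
    exact h
  have hfix := hx' _ hψσ
  -- read the equality in `Ω`
  have h1 : (((ψ σ : L'.fixingSubgroup) : N ≃ₐ[M] N) ⟨x, hxN⟩ : Ω) = (σ ⟨x, hxN'⟩ : Ω) := hψ σ ⟨x, hxN⟩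
  apply Subtype.ext
  change (σ ⟨x, hxN'⟩ : Ω) = x
  rw [← h1, hfix]

end Towers

/-! ## Characteristic bookkeeping -/

section Char

variable {S Ω : Type u} [CommRing S] [IsLocalRing S] [Field Ω] [Algebra S Ω]
  (OΩ : ValuationSubring Ω)

/-- The residue field of a valuation ring dominating a local ring of residue characteristic `p`
has characteristic `p`. [folklore] -/
theorem charP_residueField_valuationSubring_of_dominates (p : ℕ)
    (hSchar : CharP (ResidueField S) p) (hSO : ∀ s : S, algebraMap S Ω s ∈ OΩ)
    (hdom : ∀ s ∈ maximalIdeal S, OΩ.valuation (algebraMap S Ω s) < 1) :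
    CharP (ResidueField OΩ) p := by
  let f : S →+* OΩ := (algebraMap S Ω).codRestrict OΩ.toSubring hSO
  haveI : IsLocalHom f := by
    refine ⟨fun s hs => ?_⟩
    by_contra hns
    have hmem : s ∈ maximalIdeal S := (IsLocalRing.mem_maximalIdeal s).mpr hns
    have hlt := hdom s hmem
    have hunit : OΩ.valuation ((f s : OΩ) : Ω) = 1 := (OΩ.valuation_eq_one_iff (f s)).mp hs
    change OΩ.valuation (algebraMap S Ω s) = 1 at hunit
    rw [hunit] at hlt
    exact lt_irrefl _ hlt
  exact (RingHom.charP_iff_charP (ResidueField.map f) p).mp hSchar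

/-- An algebraically closed field whose valuation ring has residue characteristic `p` (a prime)
either has characteristic `p` or has characteristic `0` and contains a primitive `p`-th root of
unity. [folklore] -/
theorem charP_or_exists_isPrimitiveRoot [IsAlgClosed Ω] (p : ℕ) [hp : Fact p.Prime]
    [CharP (ResidueField OΩ) p] :
    CharP Ω p ∨ (CharZero Ω ∧ ∃ ζ : Ω, IsPrimitiveRoot ζ p) := by
  let q := ringChar Ω
  haveI hq : CharP Ω q := ringChar.charP Ω
  rcases CharP.char_is_prime_or_zero Ω q with hprime | hzero
  · -- positive characteristic: it is the residue characteristic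
    left
    have h1 : ((q : OΩ) : Ω) = 0 := by
      rw [show ((q : OΩ) : Ω) = (q : Ω) from map_natCast OΩ.subtype q]
      exact CharP.cast_eq_zero Ω q
    have h2 : (q : OΩ) = 0 := Subtype.ext h1
    have hq0 : (q : ResidueField OΩ) = 0 := by
      rw [← map_natCast (residue OΩ) q, h2, map_zero]
    have hpq : p ∣ q := (CharP.cast_eq_zero_iff (ResidueField OΩ) p q).mp hq0
    have hpq' : p = q := (Nat.prime_dvd_prime_iff_eq hp.out hprime).mp hpq
    rw [hpq']
    exact hq
  · right
    haveI : CharP Ω 0 := hzero ▸ hq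
    haveI : CharZero Ω := CharP.charP_to_charZero Ω
    refine ⟨inferInstance, ?_⟩
    haveI : NeZero (p : Ω) := ⟨Nat.cast_ne_zero.mpr hp.out.ne_zero⟩
    have hdeg : (cyclotomic p Ω).degree ≠ 0 := by
      rw [degree_cyclotomic, Nat.totient_prime hp.out]
      exact_mod_cast Nat.sub_ne_zero_of_lt hp.out.one_lt
    obtain ⟨ζ, hζ⟩ := IsAlgClosed.exists_root (cyclotomic p Ω) hdeg
    exact ⟨ζ, (isRoot_cyclotomic_iff).mp hζ⟩

end Char


/-! ## The reduction from four inputs -/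

section Parts

/-- **Cossart–Piltant 2019, Prop. 4.10 from its inputs**: the local theorem (Thm. 1.5, the
hypothesis of `CossartPiltant2019ReductionP`) together with
(COF) cofinality of local uniformizations ([CoP1] Cor. 4.6, ⇐ principalization, Cossart–Piltant
2019 Prop. 4.4), (C3) tame ascent along the Galois steps of prime degree `≠ p` between the
inertia and the ramification field ([CoP1] Prop. 6.3 as used in the proof of [CoP1] Thm. 8.1;
rank one), (C4) descent below the ramification field ([CoP1] Prop. 9.3; rank one) and
(C5) the reduction to rank-one valuations ([NSp] Thm. 1.1 / [CoP1] Prop. 5.1) — each stated in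
the climbing frame of `cossartPiltant2019ReductionP_of_climb` (a complete excellent regular local
`S` of dimension three and residue characteristic `p` inside an algebraically closed valued field
`(E, O_E)` dominating it with residue field algebraic over that of `S`; "(LU v) for the models of
`v` on a subfield `M ∋ S`" = a model `S[t] ⊆ O_E`, `t ⊆ M ⊆ Frac(S)(t)`, regular at the centre) —
imply (LU) for complete local domains of dimension three, i.e. `CossartPiltant2019ReductionP`.
The proof is the source's chain `(LU v₀) ⇒ (LU v₀ⁱ) ⇒ (LU v₀ʳ) ⇒ (LU vʳ) ⇒ (LU v)` for the
Galois closure `N` of a finite separable `L₀ ∋ ζ_p` over `F = Frac S`, followed by the purely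
inseparable climb `L₀ → K`.
[cite: CossartPiltant2019, proof of Prop. 4.10 (arXiv v1: Prop. 4.8, pp. 53–54)] -/
theorem cossartPiltant2019ReductionP_of_parts (hloc : CossartPiltant2019Local.{u})
    (hCOF :
      ∀ (p : ℕ), p.Prime →
      ∀ (S : Type u) [CommRing S] [IsDomain S] [IsRegularLocalRing S],
        IsExcellentRing S → ringKrullDim S = 3 → CharP (ResidueField S) p →
        IsAdicComplete (maximalIdeal S) S →
      ∀ (E : Type u) [Field E] [Algebra S E], Function.Injective (algebraMap S E) →
        IsAlgClosed E → Algebra.IsAlgebraic S E →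
      ∀ (OE : ValuationSubring E), (∀ s : S, algebraMap S E s ∈ OE) →
        (∀ s ∈ maximalIdeal S, OE.valuation (algebraMap S E s) < 1) →
        (∀ y : OE, ∃ q : S[X], (∃ i, q.coeff i ∉ maximalIdeal S) ∧
          OE.valuation (q.eval₂ (algebraMap S E) y) < 1) →
      ∀ (M : Subfield E), (∀ s : S, algebraMap S E s ∈ M) →
      ∀ (t : Finset E), (t : Set E) ⊆ M →
        M ≤ Subfield.closure (Set.range (algebraMap S E) ∪ (t : Set E)) →
      ∀ (hTO : (Algebra.adjoin S (t : Set E)).toSubring ≤ OE.toSubring),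
        IsRegularLocalRing (Localization.AtPrime
          (Ideal.comap (Subring.inclusion hTO) (maximalIdeal OE))) →
      ∀ (c : Finset E), (c : Set E) ⊆ M → (∀ x ∈ c, x ∈ OE) →
      ∃ t' : Finset E, (t' : Set E) ⊆ M ∧
        M ≤ Subfield.closure (Set.range (algebraMap S E) ∪ (t' : Set E)) ∧
        ∃ hTO' : (Algebra.adjoin S (t' : Set E)).toSubring ≤ OE.toSubring,
          IsRegularLocalRing (Localization.AtPrime
            (Ideal.comap (Subring.inclusion hTO') (maximalIdeal OE))) ∧
          ∀ x ∈ c, ∃ a s : E, a ∈ Algebra.adjoin S (t' : Set E) ∧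
            s ∈ Algebra.adjoin S (t' : Set E) ∧ OE.valuation s = 1 ∧ x * s = a)
    (hC3 :
      ∀ (p : ℕ), p.Prime →
      ∀ (S : Type u) [CommRing S] [IsDomain S] [IsRegularLocalRing S],
        IsExcellentRing S → ringKrullDim S = 3 → CharP (ResidueField S) p →
        IsAdicComplete (maximalIdeal S) S →
      ∀ (E : Type u) [Field E] [Algebra S E], Function.Injective (algebraMap S E) →
        IsAlgClosed E → Algebra.IsAlgebraic S E →
      ∀ (OE : ValuationSubring E), (∀ s : S, algebraMap S E s ∈ OE) →
        (∀ s ∈ maximalIdeal S, OE.valuation (algebraMap S E s) < 1) →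
        (∀ y : OE, ∃ q : S[X], (∃ i, q.coeff i ∉ maximalIdeal S) ∧
          OE.valuation (q.eval₂ (algebraMap S E) y) < 1) →
      Nonempty OE.valuation.RankOne →
      ∀ (M : Subfield E), (∀ s : S, algebraMap S E s ∈ M) →
      ∀ (N : IntermediateField M E) [FiniteDimensional M N] [IsGalois M N] (A B : Subfield E),
        (lift (fixedField (inertiaGroupIn OE N))).toSubfield ≤ A →
        B ≤ (lift (fixedField (ramificationGroupIn OE N))).toSubfield →
        IsPrimeGaloisStep p A B →
        (∃ t : Finset E, (t : Set E) ⊆ A ∧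
          A ≤ Subfield.closure (Set.range (algebraMap S E) ∪ (t : Set E)) ∧
          ∃ hTO : (Algebra.adjoin S (t : Set E)).toSubring ≤ OE.toSubring,
            IsRegularLocalRing (Localization.AtPrime
              (Ideal.comap (Subring.inclusion hTO) (maximalIdeal OE)))) →
        (∃ t : Finset E, (t : Set E) ⊆ B ∧
          B ≤ Subfield.closure (Set.range (algebraMap S E) ∪ (t : Set E)) ∧
          ∃ hTO : (Algebra.adjoin S (t : Set E)).toSubring ≤ OE.toSubring,
            IsRegularLocalRing (Localization.AtPrime
              (Ideal.comap (Subring.inclusion hTO) (maximalIdeal OE)))))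
    (hC4 :
      ∀ (p : ℕ), p.Prime →
      ∀ (S : Type u) [CommRing S] [IsDomain S] [IsRegularLocalRing S],
        IsExcellentRing S → ringKrullDim S = 3 → CharP (ResidueField S) p →
        IsAdicComplete (maximalIdeal S) S →
      ∀ (E : Type u) [Field E] [Algebra S E], Function.Injective (algebraMap S E) →
        IsAlgClosed E → Algebra.IsAlgebraic S E →
      ∀ (OE : ValuationSubring E), (∀ s : S, algebraMap S E s ∈ OE) →
        (∀ s ∈ maximalIdeal S, OE.valuation (algebraMap S E s) < 1) →
        (∀ y : OE, ∃ q : S[X], (∃ i, q.coeff i ∉ maximalIdeal S) ∧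
          OE.valuation (q.eval₂ (algebraMap S E) y) < 1) →
      Nonempty OE.valuation.RankOne →
      ∀ (M : Subfield E), (∀ s : S, algebraMap S E s ∈ M) →
      ∀ (N : IntermediateField M E) [FiniteDimensional M N] [IsGalois M N] (K' : Subfield E),
        M ≤ K' → K' ≤ (lift (fixedField (ramificationGroupIn OE N))).toSubfield →
        (∃ t : Finset E, (t : Set E) ⊆ K' ∧
          K' ≤ Subfield.closure (Set.range (algebraMap S E) ∪ (t : Set E)) ∧
          ∃ hTO : (Algebra.adjoin S (t : Set E)).toSubring ≤ OE.toSubring,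
            IsRegularLocalRing (Localization.AtPrime
              (Ideal.comap (Subring.inclusion hTO) (maximalIdeal OE)))) →
        (∃ t : Finset E, (t : Set E) ⊆ M ∧
          M ≤ Subfield.closure (Set.range (algebraMap S E) ∪ (t : Set E)) ∧
          ∃ hTO : (Algebra.adjoin S (t : Set E)).toSubring ≤ OE.toSubring,
            IsRegularLocalRing (Localization.AtPrime
              (Ideal.comap (Subring.inclusion hTO) (maximalIdeal OE)))))
    (hC5 :
      ∀ (p : ℕ), p.Prime →
      ∀ (S : Type u) [CommRing S] [IsDomain S] [IsRegularLocalRing S],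
        IsExcellentRing S → ringKrullDim S = 3 → CharP (ResidueField S) p →
        IsAdicComplete (maximalIdeal S) S →
      ∀ (E : Type u) [Field E] [Algebra S E], Function.Injective (algebraMap S E) →
        IsAlgClosed E → Algebra.IsAlgebraic S E →
      (∀ (OE : ValuationSubring E), Nonempty OE.valuation.RankOne →
        (∀ s : S, algebraMap S E s ∈ OE) →
        (∀ s ∈ maximalIdeal S, OE.valuation (algebraMap S E s) < 1) →
        (∀ y : OE, ∃ q : S[X], (∃ i, q.coeff i ∉ maximalIdeal S) ∧
          OE.valuation (q.eval₂ (algebraMap S E) y) < 1) →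
        ∀ s₀ : Finset E, ∃ t : Finset E,
            (t : Set E) ⊆ Subfield.closure (Set.range (algebraMap S E) ∪ (s₀ : Set E)) ∧
            (s₀ : Set E) ⊆ Subfield.closure (Set.range (algebraMap S E) ∪ (t : Set E)) ∧
            ∃ hTO : (Algebra.adjoin S (t : Set E)).toSubring ≤ OE.toSubring,
              IsRegularLocalRing (Localization.AtPrime
                (Ideal.comap (Subring.inclusion hTO) (maximalIdeal OE)))) →
      ∀ (OE : ValuationSubring E), (∀ s : S, algebraMap S E s ∈ OE) →
        (∀ s ∈ maximalIdeal S, OE.valuation (algebraMap S E s) < 1) →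
        (∀ y : OE, ∃ q : S[X], (∃ i, q.coeff i ∉ maximalIdeal S) ∧
          OE.valuation (q.eval₂ (algebraMap S E) y) < 1) →
        ∀ s₀ : Finset E, ∃ t : Finset E,
            (t : Set E) ⊆ Subfield.closure (Set.range (algebraMap S E) ∪ (s₀ : Set E)) ∧
            (s₀ : Set E) ⊆ Subfield.closure (Set.range (algebraMap S E) ∪ (t : Set E)) ∧
            ∃ hTO : (Algebra.adjoin S (t : Set E)).toSubring ≤ OE.toSubring,
              IsRegularLocalRing (Localization.AtPrime
                (Ideal.comap (Subring.inclusion hTO) (maximalIdeal OE)))) :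
    CossartPiltant2019ReductionP.{u} := by
  refine cossartPiltant2019ReductionP_of_climb fun _ p hp S _ _ _ hS hSdim hSchar hScomp E _ _
    hinj hE halg OE₀ hSO₀ hdom₀ hres₀ s₀' => ?_
  refine hC5 p hp S hS hSdim hSchar hScomp E hinj hE halg ?_ OE₀ hSO₀ hdom₀ hres₀ s₀'
  intro OE hrank hSO hdom hres s₀
  classical
  haveI : Fact p.Prime := ⟨hp⟩
  haveI : CharP (ResidueField OE) p :=
    charP_residueField_valuationSubring_of_dominates OE p hSchar hSO hdom
  -- the base subfield `F = Frac S ⊆ E`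
  let F₀ : Subfield E := Subfield.closure (Set.range (algebraMap S E))
  have hSF₀ : ∀ s : S, algebraMap S E s ∈ F₀ := fun s => Subfield.subset_closure ⟨s, rfl⟩
  -- every element of `E` is integral over `F`
  have hint : ∀ x : E, IsIntegral F₀ x := by
    intro x
    obtain ⟨q, hq0, hqx⟩ := Algebra.IsAlgebraic.isAlgebraic (R := S) x
    let φ : S →+* F₀ := (algebraMap S E).codRestrict F₀ hSF₀
    have hφ : Function.Injective φ := fun a b h => hinj (congrArg Subtype.val h)
    have hq' : q.map φ ≠ 0 := (Polynomial.map_ne_zero_iff hφ).mpr hq0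
    have hcomp : (algebraMap F₀ E).comp φ = algebraMap S E := RingHom.ext fun _ => rfl
    have haeval : aeval x (q.map φ) = 0 := by
      rw [aeval_def, eval₂_map, hcomp]
      exact hqx
    exact isAlgebraic_iff_isIntegral.mp ⟨q.map φ, hq', haeval⟩
  -- `K = F(s₀)`
  let Ki : IntermediateField F₀ E := IntermediateField.adjoin F₀ (s₀ : Set E)
  haveI hKifd : FiniteDimensional F₀ Ki :=
    IntermediateField.finiteDimensional_adjoin fun x _ => hint x
  have hrangeF₀ : Set.range (algebraMap F₀ E) = (F₀ : Set E) := by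
    ext z
    constructor
    · rintro ⟨w, rfl⟩
      exact w.2
    · intro hz
      exact ⟨⟨z, hz⟩, rfl⟩
  have hKi : Ki.toSubfield = Subfield.closure (Set.range (algebraMap S E) ∪ (s₀ : Set E)) := by
    change (IntermediateField.adjoin F₀ (s₀ : Set E)).toSubfield = _
    rw [IntermediateField.adjoin_toSubfield, hrangeF₀]
    apply le_antisymm
    · refine Subfield.closure_le.mpr ?_
      rintro z (hz | hz)
      · exact Subfield.closure_mono Set.subset_union_left hz
      · exact Subfield.subset_closure (Set.mem_union_right _ hz)
    · refine Subfield.closure_le.mpr ?_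
      rintro z (⟨w, rfl⟩ | hz)
      · exact Subfield.subset_closure (Set.mem_union_left _ (hSF₀ w))
      · exact Subfield.subset_closure (Set.mem_union_right _ hz)
  -- the separable part `L₀` of `K` over `F`
  let L₀ : IntermediateField F₀ E := separableClosure F₀ E ⊓ Ki
  have hL₀Ki : L₀ ≤ Ki := inf_le_right
  haveI hL₀fd : FiniteDimensional F₀ L₀ :=
    Module.Finite.of_injective (IntermediateField.inclusion hL₀Ki).toLinearMap
      (IntermediateField.inclusion_injective hL₀Ki)
  have hL₀sep : ∀ x : E, x ∈ L₀ → IsSeparable F₀ x := fun x hx =>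
    mem_separableClosure_iff.mp (inf_le_left (a := separableClosure F₀ E) (b := Ki) hx)
  have hSL₀ : ∀ s : S, algebraMap S E s ∈ L₀.toSubfield := fun s => L₀.algebraMap_mem ⟨_, hSF₀ s⟩
  have hF₀L₀ : F₀ ≤ L₀.toSubfield := fun z hz => L₀.algebraMap_mem ⟨z, hz⟩
  -- characteristic of `E` and a separable `ζ` which is `ζ_p` in characteristic `0`
  obtain ⟨ζ, hζsep, hζ⟩ : ∃ ζ : E, IsSeparable F₀ ζ ∧
      (CharP E p ∨ (CharZero E ∧ IsPrimitiveRoot ζ p)) := by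
    rcases charP_or_exists_isPrimitiveRoot OE p with h | ⟨h0, ζ, hζ⟩
    · refine ⟨1, ?_, Or.inl h⟩
      have h1 := isSeparable_algebraMap (K := E) (1 : F₀)
      rwa [map_one] at h1
    · haveI := h0
      haveI : PerfectField F₀ := PerfectField.ofCharZero
      exact ⟨ζ, (minpoly.irreducible (hint ζ)).separable, Or.inr ⟨h0, hζ⟩⟩
  -- the finite Galois extension `N | F` generated by the conjugates of a basis of `L₀` and of `ζ`
  let bL := Module.finBasis F₀ L₀
  let gens : Finset E := insert ζ (Finset.univ.image fun i => ((bL i : L₀) : E))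
  have hgens_sep : ∀ x ∈ gens, IsSeparable F₀ x := by
    intro x hx
    rcases Finset.mem_insert.mp hx with rfl | hx
    · exact hζsep
    · obtain ⟨i, -, rfl⟩ := Finset.mem_image.mp hx
      exact hL₀sep _ (bL i).2
  let P : F₀[X] := ∏ x ∈ gens, minpoly F₀ x
  have hPne : P ≠ 0 := Finset.prod_ne_zero_iff.mpr fun x _ => minpoly.ne_zero (hint x)
  have hPsplits : (P.map (algebraMap F₀ E)).Splits := IsAlgClosed.splits _
  let N : IntermediateField F₀ E := IntermediateField.adjoin F₀ (P.rootSet E)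
  haveI hsplit : P.IsSplittingField F₀ N := IntermediateField.adjoin_rootSet_isSplittingField hPsplits
  haveI : FiniteDimensional F₀ N := Polynomial.IsSplittingField.finiteDimensional N P
  haveI : Normal F₀ N := Normal.of_isSplittingField P
  have hroots_sep : ∀ y ∈ P.rootSet E, IsSeparable F₀ y := by
    intro y hy
    obtain ⟨-, hy0⟩ := Polynomial.mem_rootSet.mp hy
    rw [map_prod, Finset.prod_eq_zero_iff] at hy0
    obtain ⟨x, hx, hxy⟩ := hy0
    -- `y` is a root of the separable irreducible `minpoly F x`
    have hdvd : minpoly F₀ y ∣ minpoly F₀ x := minpoly.dvd F₀ y hxy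
    exact (hgens_sep x hx).of_dvd hdvd
  haveI : Algebra.IsSeparable F₀ N :=
    (IntermediateField.isSeparable_adjoin_iff_isSeparable F₀ E).mpr hroots_sep
  haveI : IsGalois F₀ N := isGalois_iff.mpr ⟨inferInstance, inferInstance⟩
  have hgensN : ∀ x ∈ gens, x ∈ N := fun x hx => by
    refine IntermediateField.subset_adjoin _ _ (Polynomial.mem_rootSet.mpr ⟨hPne, ?_⟩)
    rw [map_prod]
    exact Finset.prod_eq_zero hx (minpoly.aeval F₀ x)
  have hζN : ζ ∈ N := hgensN ζ (Finset.mem_insert_self _ _)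
  have hL₀N : L₀ ≤ N := by
    intro x hx
    have hrepr := bL.sum_repr ⟨x, hx⟩
    have h : ((∑ i, (bL.repr ⟨x, hx⟩ i) • bL i : L₀) : E) = x := congrArg Subtype.val hrepr
    have hmem : ((∑ i, (bL.repr ⟨x, hx⟩ i) • bL i : L₀) : E) ∈ N := by
      push_cast
      refine sum_mem fun i _ => IntermediateField.smul_mem N ?_
      exact hgensN _ (Finset.mem_insert_of_mem (Finset.mem_image.mpr ⟨i, Finset.mem_univ i, rfl⟩))
    rw [h] at hmem
    exact hmem
  -- (1) `(LU v₀)`: the base `S[∅]`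
  have hTO₀ : (Algebra.adjoin S (((∅ : Finset E) : Finset E) : Set E)).toSubring ≤ OE.toSubring := by
    intro z hz
    rw [Finset.coe_empty, Algebra.adjoin_empty] at hz
    obtain ⟨w, rfl⟩ := Algebra.mem_bot.mp hz
    exact hSO w
  have hINV₀ : ∃ t : Finset E, (t : Set E) ⊆ F₀ ∧
      F₀ ≤ Subfield.closure (Set.range (algebraMap S E) ∪ (t : Set E)) ∧
      ∃ hTO : (Algebra.adjoin S (t : Set E)).toSubring ≤ OE.toSubring,
        IsRegularLocalRing (Localization.AtPrime
          (Ideal.comap (Subring.inclusion hTO) (maximalIdeal OE))) := by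
    refine ⟨∅, by simp, ?_, hTO₀, isRegularLocalRing_centre_adjoin_empty hinj OE hSO hdom hTO₀⟩
    rw [Finset.coe_empty, Set.union_empty]
  -- (2) `(LU v₀ⁱ)`: the unramified ascent, modulo cofinality
  have hcof' : ∀ M' : Subfield E,
      (M' = F₀ ∨ M' = (lift (fixedField (decompositionGroupIn OE N))).toSubfield) →
      ∀ (t : Finset E), (t : Set E) ⊆ M' →
      M' ≤ Subfield.closure (Set.range (algebraMap S E) ∪ (t : Set E)) →
      ∀ (hTO : (Algebra.adjoin S (t : Set E)).toSubring ≤ OE.toSubring),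
      IsRegularLocalRing (Localization.AtPrime
        (Ideal.comap (Subring.inclusion hTO) (maximalIdeal OE))) →
      ∀ (c : Finset E), (c : Set E) ⊆ M' → (∀ x ∈ c, x ∈ OE) →
      ∃ t' : Finset E, (t' : Set E) ⊆ M' ∧
        M' ≤ Subfield.closure (Set.range (algebraMap S E) ∪ (t' : Set E)) ∧
        ∃ hTO' : (Algebra.adjoin S (t' : Set E)).toSubring ≤ OE.toSubring,
          IsRegularLocalRing (Localization.AtPrime
            (Ideal.comap (Subring.inclusion hTO') (maximalIdeal OE))) ∧
          ∀ x ∈ c, ∃ a s : E, a ∈ Algebra.adjoin S (t' : Set E) ∧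
            s ∈ Algebra.adjoin S (t' : Set E) ∧ OE.valuation s = 1 ∧ x * s = a := by
    intro M' hM'
    have hSM' : ∀ s : S, algebraMap S E s ∈ M' := by
      rcases hM' with rfl | rfl
      · exact hSF₀
      · exact fun s => le_lift_toSubfield _ (hSF₀ s)
    exact hCOF p hp S hS hSdim hSchar hScomp E hinj hE halg OE hSO hdom hres M' hSM'
  have hINVi := exists_model_inertiaField_of_cofinal OE F₀ N hcof' hINV₀
  -- (3) `(LU v₀ʳ)`: the tame ascent along `Fⁱ ⊆ ⋯ ⊆ Fʳ`
  have hINVr : ∃ t : Finset E,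
      (t : Set E) ⊆ (lift (fixedField (ramificationGroupIn OE N))).toSubfield ∧
      (lift (fixedField (ramificationGroupIn OE N))).toSubfield ≤
        Subfield.closure (Set.range (algebraMap S E) ∪ (t : Set E)) ∧
      ∃ hTO : (Algebra.adjoin S (t : Set E)).toSubring ≤ OE.toSubring,
        IsRegularLocalRing (Localization.AtPrime
          (Ideal.comap (Subring.inclusion hTO) (maximalIdeal OE))) :=
    IsPrimeGaloisTower.induction_between
      (A₀ := (lift (fixedField (inertiaGroupIn OE N))).toSubfield)
      (B := (lift (fixedField (ramificationGroupIn OE N))).toSubfield)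
      (fun M => ∃ t : Finset E, (t : Set E) ⊆ M ∧
        M ≤ Subfield.closure (Set.range (algebraMap S E) ∪ (t : Set E)) ∧
        ∃ hTO : (Algebra.adjoin S (t : Set E)).toSubring ≤ OE.toSubring,
          IsRegularLocalRing (Localization.AtPrime
            (Ideal.comap (Subring.inclusion hTO) (maximalIdeal OE))))
      (fun A B hA hB hstep hIA => hC3 p hp S hS hSdim hSchar hScomp E hinj hE halg OE hSO hdom
        hres hrank F₀ hSF₀ N A B hA hB hstep hIA)
      le_rfl (isPrimeGaloisTower_inertiaField_ramificationField OE N) hINVi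
  -- (4) `(LU vʳ)`: the climb above the ramification field (Thm. 1.5 (ii)), up to `L₀ · Fʳ`
  obtain ⟨L₀', hL₀', hL₀'fix⟩ :=
    exists_intermediateField_lift_toSubfield_eq N L₀.toSubfield hF₀L₀ hL₀N
  let K'' : IntermediateField F₀ N := fixedField (ramificationGroupIn OE N ⊓ L₀'.fixingSubgroup)
  have hKr : fixedField (ramificationGroupIn OE N) ≤ K'' := fun x hx =>
    (IntermediateField.mem_fixedField_iff _ _).mpr fun σ hσ =>
      (IntermediateField.mem_fixedField_iff _ _).mp hx σ hσ.1
  have hchar : CharP E p ∨ (CharZero E ∧ ∃ ζ ∈ N, IsPrimitiveRoot ζ p) :=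
    hζ.imp_right fun ⟨h0, hζ'⟩ => ⟨h0, ζ, hζN, hζ'⟩
  have hINVK := CossartPiltant2019Local.exists_model_of_ramificationField_le OE hloc p hinj hS
    hSdim hSchar hSO hdom hres F₀ hSF₀ N K'' hKr hchar hINVr
  -- (5) `(LU vʳ) ⇒ (LU)` at `L₀`: descent below the ramification field of `N | L₀`
  haveI := finiteDimensional_extendScalars_lift L₀'
  haveI := isGalois_extendScalars_lift L₀'
  have hMK : (lift L₀').toSubfield ≤ (lift K'').toSubfield := by
    intro x hx
    have hxN : x ∈ N := IntermediateField.lift_le L₀' hx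
    have hx' : (⟨x, hxN⟩ : N) ∈ L₀' := (IntermediateField.mem_lift (⟨x, hxN⟩ : N)).mp hx
    refine (IntermediateField.mem_lift (⟨x, hxN⟩ : N)).mpr ?_
    exact (IntermediateField.mem_fixedField_iff _ _).mpr fun σ hσ =>
      (IntermediateField.mem_fixingSubgroup_iff _ _).mp hσ.2 _ hx'
  have hKram := lift_fixedField_inf_fixingSubgroup_le_ramificationField N OE L₀'
  have hSL₀' : ∀ s : S, algebraMap S E s ∈ (lift L₀').toSubfield := fun s =>
    le_lift_toSubfield _ (hSF₀ s)
  have hINVL₀' := hC4 p hp S hS hSdim hSchar hScomp E hinj hE halg OE hSO hdom hres hrank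
    (lift L₀').toSubfield hSL₀' (Subfield.extendScalars (lift_toSubfield_le L₀'))
    (lift K'').toSubfield hMK hKram hINVK
  rw [hL₀'] at hINVL₀'
  -- (6) `L₀ → K`: the purely inseparable climb (characteristic `p`) / `L₀ = K` (characteristic `0`)
  have hINVKi : ∃ t : Finset E, (t : Set E) ⊆ Ki.toSubfield ∧
      Ki.toSubfield ≤ Subfield.closure (Set.range (algebraMap S E) ∪ (t : Set E)) ∧
      ∃ hTO : (Algebra.adjoin S (t : Set E)).toSubring ≤ OE.toSubring,
        IsRegularLocalRing (Localization.AtPrime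
          (Ideal.comap (Subring.inclusion hTO) (maximalIdeal OE))) := by
    haveI : Algebra.IsAlgebraic F₀ E := ⟨fun x => (hint x).isAlgebraic⟩
    rcases hζ with hcharp | ⟨hchar0, -⟩
    · haveI := hcharp
      haveI : CharP F₀ p := inferInstance
      haveI : ExpChar (separableClosure F₀ E) p := by
        haveI : CharP (separableClosure F₀ E) p := inferInstance
        exact ExpChar.prime hp
      have hpi : ∀ z ∈ Ki.toSubfield, ∃ k : ℕ, z ^ p ^ k ∈ L₀.toSubfield := by
        intro z hz
        obtain ⟨n, y, hy⟩ := IsPurelyInseparable.pow_mem (separableClosure F₀ E) p z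
        refine ⟨n, ?_⟩
        refine ⟨?_, ?_⟩
        · change z ^ p ^ n ∈ separableClosure F₀ E
          rw [← hy]
          exact y.2
        · exact Ki.toSubfield.pow_mem hz _
      have hL₀Ki' : L₀.toSubfield ≤ Ki.toSubfield := fun x hx => hL₀Ki hx
      have hfin : 0 < Subfield.relfinrank L₀.toSubfield Ki.toSubfield := by
        have hF₀Ki : F₀ ≤ Ki.toSubfield := hF₀L₀.trans hL₀Ki'
        have hmul := Subfield.relfinrank_mul_relfinrank hF₀L₀ hL₀Ki'
        have hpos : 0 < Subfield.relfinrank F₀ Ki.toSubfield := by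
          rw [Subfield.relfinrank_eq_finrank_of_le hF₀Ki]
          have heq : Subfield.extendScalars hF₀Ki = Ki := IntermediateField.toSubfield_injective rfl
          rw [heq]
          exact Module.finrank_pos
        rw [← hmul] at hpos
        exact Nat.pos_of_ne_zero fun h => by
          rw [h, mul_zero] at hpos
          exact lt_irrefl 0 hpos
      exact CossartPiltant2019Local.exists_model_of_forall_pow_mem OE hloc p hinj hS hSdim hSchar
        hSO hdom hres _ L₀.toSubfield Ki.toSubfield hL₀Ki' hSL₀ hpi rfl hfin hINVL₀'
    · haveI := hchar0
      haveI : PerfectField F₀ := PerfectField.ofCharZero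
      have hL₀Ki' : L₀ = Ki := le_antisymm hL₀Ki (le_inf (fun x _ =>
        mem_separableClosure_iff.mpr (minpoly.irreducible (hint x)).separable) le_rfl)
      rw [hL₀Ki'] at hINVL₀'
      exact hINVL₀'
  -- (7) conclusion
  obtain ⟨t, htK, hKcl, hTO, hreg⟩ := hINVKi
  refine ⟨t, by rwa [hKi] at htK, fun z hz => hKcl ?_, hTO, hreg⟩
  rw [hKi]
  exact Subfield.subset_closure (Set.mem_union_right _ hz)

end Parts

end Literature.AlgebraicGeometry.Resolution

end
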